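import Mathlib.Analysis.SpecialFunctions.ExpDeriv
import Mathlib.Analysis.Calculus.MeanValue
import Mathlib.Analysis.Calculus.LocalExtr.Rolle
import Mathlib.Analysis.Calculus.Deriv.Polynomial
import Mathlib.Data.Set.Card
import Literature.Analysis.Approximation.RealExponentialSumZeros
import HarnessLib

/-!
# Zeros of real exponential sums — proof of Braess 1986, Ch. VI §1 Lemma 1.1 (proper and extended cases)

Discharge of the named facts `Literature.Analysis.Approximation.Braess1986_VI_1_1_proper` and
`Literature.Analysis.Approximation.Braess1986_VI_1_1_extended` (`RealExponentialSumZeros.lean`): a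
real exponential sum `u(x) = ∑_{ν<k} α_ν e^{t_ν x}` either vanishes identically on `ℝ` or has at
most `k - 1` real zeros; an extended sum `∑_ν p_ν(x) e^{t_ν x}` (polynomial coefficients) either
vanishes identically or has at most `k - 1` real zeros, `k = ∑_{p_ν ≠ 0} (1 + deg p_ν)` (section
`Braess1986ExtendedProof`: the same Rolle induction, now on the order `k`, the term `ν₀` with
`p_{ν₀} ≠ 0` losing one unit of order under `u ↦ (e^{-t_{ν₀} x} u)'`).

We follow the printed proof, D. Braess, *Nonlinear Approximation Theory* (1986), Ch. VI §1,
Lemma 1.1 (held copy, PDF p. 158): induction on `k`; multiply by `e^{-t₀ x}` (same zero set), so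
that the derivative `∑_{ν ≥ 1} α_ν (t_ν - t₀) e^{(t_ν - t₀) x}` is an exponential sum with `k - 1`
terms, and apply Rolle's theorem — between two consecutive zeros of a function lies a zero of its
derivative, so a function whose derivative has at most `N` zeros has at most `N + 1`
(`Braess1986.zeros_finite_of_hasDerivAt`, from Mathlib's `exists_hasDerivAt_eq_zero`); if the
derivative vanishes identically the function is constant (`is_const_of_deriv_eq_zero`), hence
identically zero or zero-free.

## References
* [Braess1986] D. Braess, *Nonlinear Approximation Theory*, Springer Series in Computational
  Mathematics 7, Springer (1986), Ch. VI §1, Lemma 1.1.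
-/

namespace Literature.Analysis.Approximation

section Braess1986Proof

/-- **Rolle counting.** If `f` is differentiable on `ℝ` with derivative `f'` and the zero set of
`f'` is finite with at most `N` elements, then the zero set of `f` is finite with at most `N + 1`
elements (between two consecutive zeros of `f` lies a zero of `f'`). [folklore] -/
private theorem Braess1986.zeros_finite_of_hasDerivAt {f f' : ℝ → ℝ}
    (hf : ∀ x, HasDerivAt f (f' x) x) {N : ℕ} (hfin : {x | f' x = 0}.Finite)
    (hN : {x | f' x = 0}.ncard ≤ N) :
    {x | f x = 0}.Finite ∧ {x | f x = 0}.ncard ≤ N + 1 := by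
  classical
  by_contra hcon
  -- a finset of `N + 2` zeros of `f`
  obtain ⟨T, hTsub, hTcard⟩ :
      ∃ T : Finset ℝ, (↑T : Set ℝ) ⊆ {x | f x = 0} ∧ T.card = N + 2 := by
    by_cases hfin0 : {x | f x = 0}.Finite
    · have hle : N + 2 ≤ hfin0.toFinset.card := by
        rw [← Set.ncard_eq_toFinset_card _ hfin0]
        by_contra h
        exact hcon ⟨hfin0, by omega⟩
      obtain ⟨T, hT, hcard⟩ := Finset.exists_subset_card_eq hle
      exact ⟨T, fun x hx => by simpa using hT hx, hcard⟩
    · exact Set.Infinite.exists_subset_card_eq hfin0 (N + 2)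
  -- sort the zeros
  set g := T.orderEmbOfFin hTcard with hg
  have hgmem : ∀ i, g i ∈ T := fun i => Finset.orderEmbOfFin_mem T hTcard i
  have hgmono : StrictMono g := (T.orderEmbOfFin hTcard).strictMono
  have hzero : ∀ i, f (g i) = 0 := fun i => hTsub (Finset.mem_coe.mpr (hgmem i))
  -- Rolle in each of the `N + 1` gaps
  have hc : ∀ i : Fin (N + 1), ∃ c ∈ Set.Ioo (g i.castSucc) (g i.succ), f' c = 0 := by
    intro i
    refine exists_hasDerivAt_eq_zero (hgmono i.castSucc_lt_succ)
      (fun x _ => (hf x).continuousAt.continuousWithinAt) ?_ (fun x _ => hf x)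
    rw [hzero, hzero]
  choose c hcmem hczero using hc
  have hcmono : StrictMono c := by
    intro i j hij
    have hij' : i.succ ≤ j.castSucc := by
      rw [Fin.le_iff_val_le_val, Fin.val_succ, Fin.val_castSucc]
      exact Fin.lt_def.mp hij
    calc c i < g i.succ := (hcmem i).2
      _ ≤ g j.castSucc := hgmono.monotone hij'
      _ < c j := (hcmem j).1
  have hsub : Set.range c ⊆ {x | f' x = 0} := by
    rintro _ ⟨i, rfl⟩
    exact hczero i
  have h1 := Set.ncard_le_ncard hsub hfin
  rw [Set.ncard_range_of_injective hcmono.injective, Nat.card_eq_fintype_card,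
    Fintype.card_fin] at h1
  omega

/-- The derivative of a real exponential sum `∑ α_ν e^{s_ν x}` is the exponential sum
`∑ α_ν s_ν e^{s_ν x}`. [folklore] -/
private theorem Braess1986.hasDerivAt_expSum {k : ℕ} (α s : Fin k → ℝ) (x : ℝ) :
    HasDerivAt (fun y => ∑ ν, α ν * Real.exp (s ν * y))
      (∑ ν, α ν * (Real.exp (s ν * x) * s ν)) x := by
  have h : ∀ ν ∈ (Finset.univ : Finset (Fin k)),
      HasDerivAt (fun y => α ν * Real.exp (s ν * y)) (α ν * (Real.exp (s ν * x) * s ν)) x := by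
    intro ν _
    have h1 : HasDerivAt (fun y => s ν * y) (s ν) x := by
      simpa using (hasDerivAt_id' x).const_mul (s ν)
    exact (h1.exp).const_mul (α ν)
  exact HasDerivAt.fun_sum h

/-- **Braess 1986, Ch. VI §1 Lemma 1.1 (proper case) — proved** (discharge of
`Braess1986_VI_1_1_proper`; Laguerre 1898): a real exponential sum `∑_{ν<k} α_ν e^{t_ν x}` is
identically zero on `ℝ` or has a finite zero set with at most `k - 1` elements.  Printed proof:
induction on `k`, differentiate `e^{-t₀x} u(x)` and apply Rolle's theorem.
[cite: Braess1986, Ch. VI §1 Lemma 1.1 (p. 158 of the held PDF), proper case of display (1.2)] -/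
theorem Braess1986_VI_1_1_proper_holds : Braess1986_VI_1_1_proper := by
  intro k
  induction k with
  | zero =>
    intro α t
    left
    intro x
    simp
  | succ k ih =>
    intro α t
    -- the normalised sum `v = e^{-t₀ x} u`
    set v : ℝ → ℝ := fun x => ∑ ν, α ν * Real.exp ((t ν - t 0) * x) with hv
    have key : ∀ (ν : Fin (k + 1)) (x : ℝ),
        Real.exp (t 0 * x) * Real.exp ((t ν - t 0) * x) = Real.exp (t ν * x) := by
      intro ν x
      rw [← Real.exp_add]
      congr 1
      ring
    have huv : ∀ x, ∑ ν, α ν * Real.exp (t ν * x) = Real.exp (t 0 * x) * v x := by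
      intro x
      simp only [hv, Finset.mul_sum]
      refine Finset.sum_congr rfl fun ν _ => ?_
      symm
      rw [mul_left_comm, key]
    have hzeros : {x | ∑ ν, α ν * Real.exp (t ν * x) = 0} = {x | v x = 0} := by
      ext x
      simp only [Set.mem_setOf_eq, huv x, mul_eq_zero, Real.exp_ne_zero, false_or]
    have hident : (∀ x, ∑ ν, α ν * Real.exp (t ν * x) = 0) ↔ ∀ x, v x = 0 := by
      refine forall_congr' fun x => ?_
      rw [huv x]
      simp only [mul_eq_zero, Real.exp_ne_zero, false_or]
    rw [hzeros, hident]
    -- the derivative of `v` is an exponential sum with `k` terms (the `ν = 0` term drops out)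
    have hvw : ∀ x, HasDerivAt v
        (∑ ν : Fin k, (α ν.succ * (t ν.succ - t 0)) * Real.exp ((t ν.succ - t 0) * x)) x := by
      intro x
      refine (Braess1986.hasDerivAt_expSum α (fun ν => t ν - t 0) x).congr_deriv ?_
      rw [Fin.sum_univ_succ]
      simp only [sub_self, mul_zero, zero_add]
      refine Finset.sum_congr rfl fun ν _ => ?_
      ring
    rcases ih (fun ν => α ν.succ * (t ν.succ - t 0)) (fun ν => t ν.succ - t 0) with hw0 | ⟨hwfin, hwcard⟩
    · -- `v' ≡ 0`: `v` is constant, hence identically zero or zero-free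
      have hconst : ∀ x, v x = v 0 := by
        intro x
        refine is_const_of_deriv_eq_zero (fun y => (hvw y).differentiableAt) (fun y => ?_) x 0
        rw [(hvw y).deriv]
        exact hw0 y
      by_cases h0 : v 0 = 0
      · left
        intro x
        rw [hconst x, h0]
      · right
        have hempty : {x | v x = 0} = ∅ := by
          ext x
          simp only [Set.mem_setOf_eq, Set.mem_empty_iff_false, iff_false]
          rw [hconst x]
          exact h0
        rw [hempty]
        exact ⟨Set.finite_empty, by simp⟩
    · right
      cases k with
      | zero =>
        -- `v'` is the empty sum: its zero set is all of `ℝ`, which is not finite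
        exfalso
        have hfin' : (Set.univ : Set ℝ).Finite := by simpa using hwfin
        exact Set.infinite_univ hfin'
      | succ k =>
        have h := Braess1986.zeros_finite_of_hasDerivAt hvw hwfin hwcard
        exact ⟨h.1, by have h2 := h.2; omega⟩

end Braess1986Proof

section Braess1986ExtendedProof

open Polynomial

/-- The derivative of an extended exponential sum `∑ p_ν(y) e^{s_ν y}` is the extended exponential sum
with coefficients `p_ν' + s_ν p_ν`. [folklore] -/
private theorem Braess1986.hasDerivAt_polyExpSum {m : ℕ} (p : Fin m → ℝ[X]) (s : Fin m → ℝ) (x : ℝ) :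
    HasDerivAt (fun y => ∑ ν, (p ν).eval y * Real.exp (s ν * y))
      (∑ ν, (derivative (p ν) + C (s ν) * p ν).eval x * Real.exp (s ν * x)) x := by
  have h : ∀ ν ∈ (Finset.univ : Finset (Fin m)),
      HasDerivAt (fun y => (p ν).eval y * Real.exp (s ν * y))
        ((derivative (p ν) + C (s ν) * p ν).eval x * Real.exp (s ν * x)) x := by
    intro ν _
    have h1 : HasDerivAt (fun y => s ν * y) (s ν) x := by
      simpa using (hasDerivAt_id' x).const_mul (s ν)
    have h2 := ((p ν).hasDerivAt x).mul (h1.exp)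
    refine h2.congr_deriv ?_
    simp only [eval_add, eval_mul, eval_C]
    ring
  exact HasDerivAt.fun_sum h

/-- Order bookkeeping for the Rolle step: passing from `p_ν` to `p_ν' + (t_ν − t₀)·p_ν` does not raise any
term's contribution `[p_ν ≠ 0]·(deg p_ν + 1)` to the order, and lowers the `ν₀`-th one (`t₀ = t_{ν₀}`,
`p_{ν₀} ≠ 0`). [folklore] -/
private theorem Braess1986.order_step {m : ℕ} (p : Fin m → ℝ[X]) (t : Fin m → ℝ) (ν₀ : Fin m)
    (hν₀ : p ν₀ ≠ 0) :
    (∑ ν, if derivative (p ν) + C (t ν - t ν₀) * p ν = 0 then 0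
        else (derivative (p ν) + C (t ν - t ν₀) * p ν).natDegree + 1) + 1
      ≤ ∑ ν, if p ν = 0 then 0 else (p ν).natDegree + 1 := by
  classical
  -- termwise: new ≤ old
  have hle : ∀ ν, (if derivative (p ν) + C (t ν - t ν₀) * p ν = 0 then 0
      else (derivative (p ν) + C (t ν - t ν₀) * p ν).natDegree + 1)
        ≤ (if p ν = 0 then 0 else (p ν).natDegree + 1) := by
    intro ν
    by_cases hp : p ν = 0
    · simp [hp]
    · rw [if_neg hp]
      split_ifs with hP
      · exact Nat.zero_le _
      · have h1 : (derivative (p ν) + C (t ν - t ν₀) * p ν).natDegree ≤ (p ν).natDegree :=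
          (natDegree_add_le _ _).trans (max_le ((natDegree_derivative_le (p ν)).trans (Nat.sub_le _ _))
            (natDegree_C_mul_le _ _))
        omega
  -- the ν₀ term drops strictly: the new polynomial there is `p_{ν₀}'`
  have hlt : (if derivative (p ν₀) + C (t ν₀ - t ν₀) * p ν₀ = 0 then 0
      else (derivative (p ν₀) + C (t ν₀ - t ν₀) * p ν₀).natDegree + 1) + 1
        ≤ (if p ν₀ = 0 then 0 else (p ν₀).natDegree + 1) := by
    rw [if_neg hν₀, sub_self, map_zero, zero_mul, add_zero]
    split_ifs with hP
    · omega
    · have h1 := natDegree_derivative_le (p ν₀)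
      have h2 : 0 < (p ν₀).natDegree := by
        by_contra h0
        apply hP
        have : (p ν₀).natDegree = 0 := by omega
        exact derivative_of_natDegree_zero this
      omega
  have hsplit₁ := Finset.add_sum_erase (Finset.univ : Finset (Fin m))
    (fun ν => if derivative (p ν) + C (t ν - t ν₀) * p ν = 0 then 0
      else (derivative (p ν) + C (t ν - t ν₀) * p ν).natDegree + 1) (Finset.mem_univ ν₀)
  have hsplit₂ := Finset.add_sum_erase (Finset.univ : Finset (Fin m))
    (fun ν => if p ν = 0 then 0 else (p ν).natDegree + 1) (Finset.mem_univ ν₀)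
  have hrest : ∑ ν ∈ (Finset.univ : Finset (Fin m)).erase ν₀,
      (if derivative (p ν) + C (t ν - t ν₀) * p ν = 0 then 0 else (derivative (p ν) + C (t ν - t ν₀) * p ν).natDegree + 1)
        ≤ ∑ ν ∈ (Finset.univ : Finset (Fin m)).erase ν₀, (if p ν = 0 then 0 else (p ν).natDegree + 1) :=
    Finset.sum_le_sum fun ν _ => hle ν
  rw [← hsplit₁, ← hsplit₂]
  omega

/-- The Rolle induction of Braess VI §1 Lemma 1.1 for extended sums, on the order `n`. [folklore] -/
private theorem Braess1986.extended_aux : ∀ (n m : ℕ) (p : Fin m → ℝ[X]) (t : Fin m → ℝ),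
    (∑ ν, if p ν = 0 then 0 else (p ν).natDegree + 1) ≤ n →
    ((∀ x : ℝ, ∑ ν, (p ν).eval x * Real.exp (t ν * x) = 0) ∨
      ({x : ℝ | ∑ ν, (p ν).eval x * Real.exp (t ν * x) = 0}.Finite ∧
        {x : ℝ | ∑ ν, (p ν).eval x * Real.exp (t ν * x) = 0}.ncard ≤
          (∑ ν, if p ν = 0 then 0 else (p ν).natDegree + 1) - 1)) := by
  classical
  intro n
  induction n with
  | zero =>
    intro m p t hn
    left
    have hp : ∀ ν, p ν = 0 := by
      intro ν
      by_contra h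
      have : 1 ≤ ∑ ν, if p ν = 0 then 0 else (p ν).natDegree + 1 := by
        calc 1 ≤ (if p ν = 0 then 0 else (p ν).natDegree + 1) := by rw [if_neg h]; omega
          _ ≤ _ := Finset.single_le_sum (f := fun ν => if p ν = 0 then 0 else (p ν).natDegree + 1)
                (fun _ _ => Nat.zero_le _) (Finset.mem_univ ν)
      omega
    intro x
    simp [hp]
  | succ n ih =>
    intro m p t hn
    by_cases hall : ∀ ν, p ν = 0
    · left; intro x; simp [hall]
    obtain ⟨ν₀, hν₀⟩ := not_forall.mp hall
    -- the normalised sum `v = e^{-t₀ x} u`, `t₀ = t ν₀`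
    set v : ℝ → ℝ := fun x => ∑ ν, (p ν).eval x * Real.exp ((t ν - t ν₀) * x) with hv
    have key : ∀ (ν : Fin m) (x : ℝ),
        Real.exp (t ν₀ * x) * Real.exp ((t ν - t ν₀) * x) = Real.exp (t ν * x) := by
      intro ν x
      rw [← Real.exp_add]
      congr 1
      ring
    have huv : ∀ x, ∑ ν, (p ν).eval x * Real.exp (t ν * x) = Real.exp (t ν₀ * x) * v x := by
      intro x
      simp only [hv, Finset.mul_sum]
      refine Finset.sum_congr rfl fun ν _ => ?_
      rw [← key ν x]
      ring
    have hzeros : {x | ∑ ν, (p ν).eval x * Real.exp (t ν * x) = 0} = {x | v x = 0} := by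
      ext x
      simp only [Set.mem_setOf_eq, huv x, mul_eq_zero, Real.exp_ne_zero, false_or]
    have hident : (∀ x, ∑ ν, (p ν).eval x * Real.exp (t ν * x) = 0) ↔ ∀ x, v x = 0 := by
      refine forall_congr' fun x => ?_
      rw [huv x]
      simp only [mul_eq_zero, Real.exp_ne_zero, false_or]
    rw [hzeros, hident]
    -- the derivative of `v` is an extended sum of order ≤ n
    set P : Fin m → ℝ[X] := fun ν => derivative (p ν) + C (t ν - t ν₀) * p ν with hP
    have hvw : ∀ x, HasDerivAt v (∑ ν, (P ν).eval x * Real.exp ((t ν - t ν₀) * x)) x := fun x =>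
      Braess1986.hasDerivAt_polyExpSum p (fun ν => t ν - t ν₀) x
    have horder : (∑ ν, if P ν = 0 then 0 else (P ν).natDegree + 1) + 1
        ≤ ∑ ν, if p ν = 0 then 0 else (p ν).natDegree + 1 := Braess1986.order_step p t ν₀ hν₀
    have hordn : (∑ ν, if P ν = 0 then 0 else (P ν).natDegree + 1) ≤ n := by omega
    rcases ih m P (fun ν => t ν - t ν₀) hordn with hw0 | ⟨hwfin, hwcard⟩
    · -- `v' ≡ 0`: `v` is constant, hence identically zero or zero-free
      have hconst : ∀ x, v x = v 0 := by
        intro x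
        refine is_const_of_deriv_eq_zero (fun y => (hvw y).differentiableAt) (fun y => ?_) x 0
        rw [(hvw y).deriv]
        exact hw0 y
      by_cases h0 : v 0 = 0
      · left
        intro x
        rw [hconst x, h0]
      · right
        have hempty : {x | v x = 0} = ∅ := by
          ext x
          simp only [Set.mem_setOf_eq, Set.mem_empty_iff_false, iff_false]
          rw [hconst x]
          exact h0
        rw [hempty]
        exact ⟨Set.finite_empty, by simp⟩
    · right
      -- the order of `P` is positive (else `v' ≡ 0` has an infinite zero set)
      have hPpos : 1 ≤ ∑ ν, if P ν = 0 then 0 else (P ν).natDegree + 1 := by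
        by_contra hlt
        have hP0 : ∀ ν, P ν = 0 := by
          intro ν
          by_contra h
          have : 1 ≤ ∑ ν, if P ν = 0 then 0 else (P ν).natDegree + 1 := by
            calc 1 ≤ (if P ν = 0 then 0 else (P ν).natDegree + 1) := by rw [if_neg h]; omega
              _ ≤ _ := Finset.single_le_sum (f := fun ν => if P ν = 0 then 0 else (P ν).natDegree + 1)
                    (fun _ _ => Nat.zero_le _) (Finset.mem_univ ν)
          exact hlt this
        have huniv : {x : ℝ | ∑ ν, (P ν).eval x * Real.exp ((t ν - t ν₀) * x) = 0} = Set.univ := by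
          ext x; simp [hP0]
        rw [huniv] at hwfin
        exact Set.infinite_univ hwfin
      have h := Braess1986.zeros_finite_of_hasDerivAt hvw hwfin hwcard
      refine ⟨h.1, ?_⟩
      have h2 := h.2
      omega

/-- **Braess 1986, Ch. VI §1 Lemma 1.1 (extended case) — proved** (discharge of
`Braess1986_VI_1_1_extended`): an extended real exponential sum `∑_ν p_ν(x) e^{t_ν x}` is identically
zero on `ℝ` or has a finite zero set with at most `k - 1` elements, `k = ∑_{p_ν ≠ 0} (deg p_ν + 1)`.
Printed proof: induction on the order, differentiate `e^{-t₀x} u(x)` (`t₀ = t_{ν₀}` with `p_{ν₀} ≠ 0`: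
the order drops by at least one) and apply Rolle's theorem.
[cite: Braess1986, Ch. VI §1 Lemma 1.1 (p. 158 of the held PDF), extended sums of display (1.3)] -/
theorem Braess1986_VI_1_1_extended_holds : Braess1986_VI_1_1_extended := fun m p t =>
  Braess1986.extended_aux _ m p t le_rfl

end Braess1986ExtendedProof

end Literature.Analysis.Approximation
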